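/-
Copyright: the b2b-balaban cell (near-miss cell 7), T⁴-continuum CRUX team (coordinator ruling e34b3e0c item (2)),
lineage t4-ne7b-formalise-leaf-04 (gen 24). Released under the licence of the surrounding project.
-/
import Summits.QuantumFields.BalabanUV.T4Continuum.Spine.NE7b.HealingMapCarrier

/-!
# PH-b ON THE CARRIER — what «healing is an endomorphism of the index family» means for the skeleton `HIndex` of
# M1 ∕ M2-A, its kernel reduction to ONE hereditary-admissibility clause, a model and a counter-model
# (route R-H of `t4/ROUTES-NE7b.md` v3.1, prediction PH-b; refuter PRICING-NE7b v3 «carrier check OWED owner ∕ leaf-04»)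

Cell `pub-balaban`, sub-cell `t4`, spine estimate NE7b (node U5c), candidate route R-H «Peierls healing map».  The
refuter's PRICING-NE7b v3 grades PH-b «PASSES on paper [P-geometry] ((1.76) p. 381 and the S-operation p. 384 of
[Balaban1989LargeFieldII] are componentwise; no two other components were joined THROUGH a maximal C) — carrier check
on `Support/B16HistoryIndexedFamily` p248924's admissibility predicate OWED (owner ∕ leaf-04; decidable there)», and the
owner (journal «PH-b carrier check is with leaf-04-g24») hands it to this lineage.  THE CARRIER CHECK, honestly:

(1) LOCATED.  The carrier M1 ∕ M2-A (`B16HistoryIndexedRepr.HIndex`, p248682 ∕ p248924) carries NO admissibility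
PREDICATE: the outer index `Adm` is an ABSTRACT finite type with projections `Zc` (components of the new region) and
`Ys` (the second-class family) and `index_inj`; the three history-choice sets `HZs ∕ HYs ∕ HCs` are abstract finite
sets.  Bałaban's clauses ((1.76), the S-operation, separation) enter only when M2-B INSTANTIATES `Adm` by the
level-indexed admissible families.  So PH-b is not decidable on p248924 as it stands; what IS decidable now is its
SHAPE, and that is what this file settles in the kernel.
(2) THE SHAPE (§1): `HIndex.HealingData I Pin` — the data that make ONE level's skeleton HEALING-CLOSED for pinned
objects `x : Pin` (a second-class component `comp x` WITH its pinned sub-history): the healed summand `drop a x` with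
`Zc (drop a x) = Zc a`, `Ys (drop a x) = (Ys a).erase (comp x)`; re-indexings `mapZ ∕ mapL ∕ mapC` of the three
choice sets into those of `drop a x`, injective where it matters (`mapL` on the choices that CARRY `x`'s pinned
sub-history — the pin is what makes forgetting `C`'s sub-history injective, route text H1 (2)).  KERNEL (§2): from a
family `HD K : HealingData (I K) Pin` the lifted map `liftLevel I (fun K => (HD K).healChoice x)` satisfies H1 (1)
`…_mem_termSet` and H1 (2) `…_injOn` on the bad sub-family of `x` — i.e. EXACTLY the fields `heal_mem` ∕ `heal_injOn`
of `NE7b.HealingMap.HealingLaws` over `T := HIndex.termSet I` (`drop_inj`: the healed summand determines the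
original one, by `index_inj` and `insert_erase`).
(3) THE ONE CLAUSE M2-B MUST MEET (§3, model): if the admissibility notion that instantiates `Adm` — ANY decidable
predicate `adm` on (new-region components, second-class family) — is HEREDITARY under erasing one member of the
second-class family with the new region fixed (`adm (Z, S) → C ∈ S → adm (Z, S.erase C)`: what «(1.76) componentwise +
the S-operation componentwise» delivers on paper), then the generated skeleton `admSkeleton` CARRIES healing data with
EVERY component pinnable (`admHealing`).  COUNTER-MODEL (§3): a non-hereditary clause (toy: «the second-class family
is empty or everything», two components) admits NO pin at all (`toy_not_healable`) — the kernel form of the route's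
«one place it can fail».  So PH-b on the carrier ⟺ heredity of M2-B's admissibility predicate under single erasure
(plus the sub-history re-indexings, which are bookkeeping); nothing else is hidden in the skeleton.

[folklore] finite combinatorics; nothing of Bałaban's asserted; no `def … : Prop` fact (the structure is DATA + laws,
consumed as a hypothesis; `BadChoice` ∕ the model's `adm` are predicates WITH parameters); zero `sorry`.  BY-NAME
EFFECT ON THE WALL (`WALL-NE7b-P1.md` §2): NONE.  NE7b NOT PRINTED, NOT PROVED; spine PROVED 0∕9; rung (B)+1 on a
FINITE torus T⁴ — NOT infinite volume, NOT the mass gap, NOT Clay.  POLICY (ruling e34b3e0c): crux-route work of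
item (2) (PH-b carrier check asked of this lineage by the refuter's PRICING v3 and the owner); NOT a
`T4Continuum/Support` leaf.
HONEST DEPENDENCY: continuum YM on T⁴ ⇐ BetaPertH ∧ nine spine estimates (0/9 proved); BetaPertH ⇐ (D1) ∧ (D4) ∧
CAP+tail; G-an2-4 gates asym, D1 and NE2/3/4.  This file changes none of it.
-/

set_option autoImplicit false

open Finset
open Literature.MathematicalPhysics.QuantumFieldTheory.Balaban1983to89

namespace Summit.QuantumFields.BalabanUV.T4Continuum.B16HistoryIndexedRepr

namespace HIndex

/-! ## §1 Healing data on one skeleton -/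

/-- **HEALING DATA on ONE level's index skeleton** (route R-H, H1 on the carrier).  `Pin` = the pinned objects (a
second-class component `comp x` together with its pinned sub-history); `drop a x` = the outer summand with `comp x`
HEALED (junk unless `comp x ∈ Ys a`): same new region, second-class family minus `comp x`; `mapZ ∕ mapL ∕ mapC`
re-index the history choices of `a` as choices of `drop a x` (the new region's histories and the curly summands are
untouched by healing and re-indexed injectively; the sub-history choice FORGETS `comp x`'s coordinate and is injective
on the choices that carry `x`'s pinned sub-history, `carries`).  Displayed data + laws; which `drop` is Bałaban's is
M2-B's reading. [folklore] -/
structure HealingData {Dom : Type*} [DecidableEq Dom] (I : HIndex Dom) (Pin : Type*) where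
  /-- the healed component of a pinned object -/
  comp : Pin → Dom
  /-- the healed outer summand -/
  drop : I.Adm → Pin → I.Adm
  /-- healing keeps the new region -/
  Zc_drop : ∀ a x, comp x ∈ I.Ys a → I.Zc (drop a x) = I.Zc a
  /-- healing erases exactly the healed component from the second-class family -/
  Ys_drop : ∀ a x, comp x ∈ I.Ys a → I.Ys (drop a x) = (I.Ys a).erase (comp x)
  /-- re-indexing of the new region's histories -/
  mapZ : I.Adm → Pin → I.HZ → I.HZ
  mapZ_mem : ∀ a x, comp x ∈ I.Ys a → ∀ h ∈ I.HZs a, mapZ a x h ∈ I.HZs (drop a x)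
  mapZ_inj : ∀ a x, comp x ∈ I.Ys a → Set.InjOn (mapZ a x) ↑(I.HZs a)
  /-- «the sub-history choice `l` gives `comp x` the pinned sub-history of `x`» -/
  carries : I.Adm → Pin → I.HL → Prop
  /-- forgetting the healed component's sub-history -/
  mapL : I.Adm → Pin → I.HL → I.HL
  mapL_mem : ∀ a x, comp x ∈ I.Ys a → ∀ l ∈ I.HYs a, carries a x l → mapL a x l ∈ I.HYs (drop a x)
  mapL_inj : ∀ a x, comp x ∈ I.Ys a → Set.InjOn (mapL a x) {l | l ∈ I.HYs a ∧ carries a x l}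
  /-- re-indexing of the curly summands -/
  mapC : I.Adm → Pin → I.HC → I.HC
  mapC_mem : ∀ a x, comp x ∈ I.Ys a → ∀ c ∈ I.HCs a, mapC a x c ∈ I.HCs (drop a x)
  mapC_inj : ∀ a x, comp x ∈ I.Ys a → Set.InjOn (mapC a x) ↑(I.HCs a)

namespace HealingData

variable {Dom : Type*} [DecidableEq Dom] {I : HIndex Dom} {Pin : Type*} (D : HealingData I Pin)

/-- The second-class family is the healed one plus the healed component. [folklore] -/
theorem Ys_eq_insert (a : I.Adm) (x : Pin) (hx : D.comp x ∈ I.Ys a) :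
    I.Ys a = insert (D.comp x) (I.Ys (D.drop a x)) := by
  rw [D.Ys_drop a x hx, Finset.insert_erase hx]

/-- **THE HEALED SUMMAND DETERMINES THE ORIGINAL** (`index_inj` + `insert_erase`): healing a pinned component is
injective on the outer summands that contain it. [folklore] -/
theorem drop_inj (x : Pin) {a a' : I.Adm} (ha : D.comp x ∈ I.Ys a) (ha' : D.comp x ∈ I.Ys a')
    (h : D.drop a x = D.drop a' x) : a = a' :=
  I.index_inj a a' (by rw [← D.Zc_drop a x ha, ← D.Zc_drop a' x ha', h])
    (by rw [D.Ys_eq_insert a x ha, D.Ys_eq_insert a' x ha', h])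

/-- **THE HEALING MAP of the pinned object `x` on one level's (summand, history-choice) pairs.** [folklore] -/
def healChoice (x : Pin) : (Σ _ : I.Adm, I.HZ × I.HL × I.HC) → (Σ _ : I.Adm, I.HZ × I.HL × I.HC)
  | ⟨a, ι⟩ => ⟨D.drop a x, (D.mapZ a x ι.1, D.mapL a x ι.2.1, D.mapC a x ι.2.2)⟩

/-- The healing map on a pair, unfolded. [folklore] -/
@[simp] theorem healChoice_mk (x : Pin) (a : I.Adm) (ι : I.HZ × I.HL × I.HC) :
    D.healChoice x ⟨a, ι⟩ = ⟨D.drop a x, (D.mapZ a x ι.1, D.mapL a x ι.2.1, D.mapC a x ι.2.2)⟩ := rfl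

/-- **THE BAD PAIRS of `x`**: the healed component belongs to the summand's second-class family and the sub-history
choice carries `x`'s pin. [folklore] -/
def BadChoice (x : Pin) (p : Σ _ : I.Adm, I.HZ × I.HL × I.HC) : Prop :=
  D.comp x ∈ I.Ys p.1 ∧ D.carries p.1 x p.2.2.1

/-- H1 (1) on one level: healing a bad pair whose choice lies in `LIdx a` gives a choice in `LIdx (drop a x)`.
[folklore] -/
theorem healChoice_mem_LIdx (x : Pin) {a : I.Adm} {ι : I.HZ × I.HL × I.HC} (hι : ι ∈ I.LIdx a)
    (hb : D.BadChoice x ⟨a, ι⟩) : (D.healChoice x ⟨a, ι⟩).2 ∈ I.LIdx (D.healChoice x ⟨a, ι⟩).1 := by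
  simp only [HIndex.LIdx, Finset.mem_product] at hι ⊢
  exact ⟨D.mapZ_mem a x hb.1 _ hι.1, D.mapL_mem a x hb.1 _ hι.2.1 hb.2, D.mapC_mem a x hb.1 _ hι.2.2⟩

/-- H1 (2) on one level: the healing map is injective on the bad pairs of `x` with choices in the level's index sets.
[folklore] -/
theorem healChoice_inj (x : Pin) {a a' : I.Adm} {ι ι' : I.HZ × I.HL × I.HC} (hι : ι ∈ I.LIdx a)
    (hι' : ι' ∈ I.LIdx a') (hb : D.BadChoice x ⟨a, ι⟩) (hb' : D.BadChoice x ⟨a', ι'⟩)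
    (h : D.healChoice x ⟨a, ι⟩ = D.healChoice x ⟨a', ι'⟩) : (⟨a, ι⟩ : Σ _ : I.Adm, I.HZ × I.HL × I.HC) = ⟨a', ι'⟩ := by
  simp only [healChoice_mk] at h
  obtain ⟨hdrop, hrest⟩ := Sigma.mk.inj_iff.mp h
  have haa : a = a' := D.drop_inj x hb.1 hb'.1 hdrop
  subst haa
  have hrest' := eq_of_heq hrest
  simp only [Prod.mk.injEq] at hrest'
  simp only [HIndex.LIdx, Finset.mem_product] at hι hι'
  obtain ⟨hZ, hL, hC⟩ := hrest'
  have e1 : ι.1 = ι'.1 := D.mapZ_inj a x hb.1 (Finset.mem_coe.mpr hι.1) (Finset.mem_coe.mpr hι'.1) hZ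
  have e2 : ι.2.1 = ι'.2.1 := D.mapL_inj a x hb.1 ⟨hι.2.1, hb.2⟩ ⟨hι'.2.1, hb'.2⟩ hL
  have e3 : ι.2.2 = ι'.2.2 := D.mapC_inj a x hb.1 (Finset.mem_coe.mpr hι.2.2) (Finset.mem_coe.mpr hι'.2.2) hC
  have eι : ι = ι' := Prod.ext e1 (Prod.ext e2 e3)
  rw [eι]

end HealingData

/-! ## §2 H1 (1)(2) for the lifted healing map on the cutoff-indexed carrier -/

section Family

variable {DomK : ℕ → Type*} [∀ K, DecidableEq (DomK K)] {I : (K : ℕ) → HIndex (DomK K)} {Pin : Type*}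
  (HD : (K : ℕ) → HealingData (I K) Pin)

/-- **H1 (1) ON THE CARRIER = `HealingLaws.heal_mem`**: a term `(K, a, ι)` of `T K` that is bad for `x` is healed
INTO `T K` by the lifted map `liftLevel I (fun K => (HD K).healChoice x)`. [folklore] -/
theorem liftLevel_healChoice_mem_termSet (x : Pin) {K : ℕ} {a : (I K).Adm}
    {ι : (I K).HZ × (I K).HL × (I K).HC} (hτ : (⟨K, a, ι⟩ : Idx I) ∈ termSet I K)
    (hb : (HD K).BadChoice x ⟨a, ι⟩) :
    liftLevel I (fun K => (HD K).healChoice x) ⟨K, a, ι⟩ ∈ termSet I K := by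
  have hι : ι ∈ (I K).LIdx a := (mem_levelSet_iff I ⟨a, ι⟩).mp ((mk_mem_termSet_iff I ⟨a, ι⟩).mp hτ)
  exact liftLevel_mem_termSet
    ((mem_levelSet_iff I _).mpr ((HD K).healChoice_mem_LIdx x hι hb))

/-- **H1 (2) ON THE CARRIER = `HealingLaws.heal_injOn`**: on any finite family `S` of terms of cutoff `K` that are
all bad for `x`, the lifted healing map is injective. [folklore] -/
theorem liftLevel_healChoice_injOn (x : Pin) {K : ℕ} {S : Finset (Idx I)} (hS : S ⊆ termSet I K)
    (hbad : ∀ (a : (I K).Adm) (ι : (I K).HZ × (I K).HL × (I K).HC),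
      (⟨K, a, ι⟩ : Idx I) ∈ S → (HD K).BadChoice x ⟨a, ι⟩) :
    Set.InjOn (liftLevel I (fun K => (HD K).healChoice x)) ↑S := by
  refine liftLevel_injOn hS fun p p' hp hp' h => ?_
  obtain ⟨a, ι⟩ := p
  obtain ⟨a', ι'⟩ := p'
  have hι : ι ∈ (I K).LIdx a := (mem_levelSet_iff I ⟨a, ι⟩).mp ((mk_mem_termSet_iff I ⟨a, ι⟩).mp (hS hp))
  have hι' : ι' ∈ (I K).LIdx a' :=
    (mem_levelSet_iff I ⟨a', ι'⟩).mp ((mk_mem_termSet_iff I ⟨a', ι'⟩).mp (hS hp'))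
  exact (HD K).healChoice_inj x hι hι' (hbad a ι hp) (hbad a' ι' hp') h

end Family

end HIndex

end Summit.QuantumFields.BalabanUV.T4Continuum.B16HistoryIndexedRepr

/-! ## §3 The one clause: hereditary admissibility carries healing data; a non-hereditary clause admits no pin -/

namespace Summit.QuantumFields.BalabanUV.T4Continuum.NE7b.HealingMapSkeleton

open Summit.QuantumFields.BalabanUV.T4Continuum.B16HistoryIndexedRepr

variable (Dom : Type) [Fintype Dom] [DecidableEq Dom]

/-- **THE SKELETON GENERATED BY A DECIDABLE ADMISSIBILITY PREDICATE** on (components of the new region, second-class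
family) over a finite component type, with trivial history-choice sets (the histories are bookkeeping for PH-b; the
admissibility of the FAMILY is the point).  The all-small summand is `(∅, ∅)`, which must be admissible.
(Reducible, so that the generated `Adm` is SEEN as the subtype `{p // adm p}`.) [folklore] -/
abbrev admSkeleton (adm : Finset Dom × Finset Dom → Prop) [DecidablePred adm] (h0 : adm (∅, ∅)) : HIndex Dom where
  Adm := {p : Finset Dom × Finset Dom // adm p}
  Zc a := a.1.1
  Ys a := a.1.2
  index_inj _ _ hZ hY := Subtype.ext (Prod.ext hZ hY)
  HZ := Unit
  HL := Unit
  HC := Unit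
  HZs _ := {()}
  HYs _ := {()}
  HCs _ := {()}
  allSmall := ⟨(∅, ∅), h0⟩
  Zc_allSmall := rfl
  Ys_allSmall := rfl
  hz₀ := ()
  HZs_allSmall := rfl
  hl₀ := ()
  HYs_allSmall := rfl

variable {Dom}

/-- **HEREDITARY ADMISSIBILITY ⟹ HEALING DATA WITH EVERY COMPONENT PINNABLE** (the kernel form of the refuter's paper
PASS «(1.76) and the S-operation are componentwise»): if erasing one member of the second-class family, new region
fixed, preserves admissibility, the generated skeleton is healing-closed — `drop (Z, S) C = (Z, S.erase C)`.
[folklore] -/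
def admHealing (adm : Finset Dom × Finset Dom → Prop) [DecidablePred adm] (h0 : adm (∅, ∅))
    (hered : ∀ (Z S : Finset Dom) (C : Dom), adm (Z, S) → C ∈ S → adm (Z, S.erase C)) :
    HIndex.HealingData (admSkeleton Dom adm h0) Dom where
  comp C := C
  drop a C := if h : C ∈ a.1.2 then ⟨(a.1.1, a.1.2.erase C), hered a.1.1 a.1.2 C (by simpa using a.2) h⟩ else a
  Zc_drop a C hC := by
    show (if h : C ∈ a.1.2 then _ else a).1.1 = a.1.1
    rw [dif_pos hC]
  Ys_drop a C hC := by
    show (if h : C ∈ a.1.2 then _ else a).1.2 = a.1.2.erase C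
    rw [dif_pos hC]
  mapZ _ _ h := h
  mapZ_mem _ _ _ h hh := hh
  mapZ_inj _ _ _ := Set.injOn_id _
  carries _ _ _ := True
  mapL _ _ l := l
  mapL_mem _ _ _ l hl _ := hl
  mapL_inj _ _ _ := fun _ _ _ _ h => h
  mapC _ _ c := c
  mapC_mem _ _ _ c hc := hc
  mapC_inj _ _ _ := Set.injOn_id _

/-- In the hereditary model EVERY component of EVERY admissible second-class family is a healable pin: the healed
summand is admissible and is exactly «same new region, family minus `C`». [folklore] -/
theorem admHealing_drop_val (adm : Finset Dom × Finset Dom → Prop) [DecidablePred adm] (h0 : adm (∅, ∅))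
    (hered : ∀ (Z S : Finset Dom) (C : Dom), adm (Z, S) → C ∈ S → adm (Z, S.erase C))
    (a : (admSkeleton Dom adm h0).Adm) (C : Dom) (hC : C ∈ a.1.2) :
    ((admHealing adm h0 hered).drop a C).1 = (a.1.1, a.1.2.erase C) ∧ adm (a.1.1, a.1.2.erase C) := by
  constructor
  · show (if h : C ∈ a.1.2 then _ else a).1 = (a.1.1, a.1.2.erase C)
    rw [dif_pos hC]
  · exact hered a.1.1 a.1.2 C (by simpa using a.2) hC

/-- THE NON-HEREDITARY TOY: two components; a second-class family is admissible iff it is EMPTY or EVERYTHING (a clause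
on the family as a whole, not componentwise). [folklore] -/
def toyAdm (p : Finset (Fin 2) × Finset (Fin 2)) : Prop := p.2 = ∅ ∨ p.2 = Finset.univ

/-- The toy clause is decidable. [folklore] -/
instance toyAdm.instDecidablePred : DecidablePred toyAdm :=
  fun p => inferInstanceAs (Decidable (p.2 = ∅ ∨ p.2 = Finset.univ))

/-- The all-small summand of the toy is admissible. [folklore] -/
theorem toyAdm_empty : toyAdm (∅, ∅) := Or.inl rfl

/-- **COUNTER-MODEL (the route's «one place PH-b can fail», kernel form): under a NON-hereditary admissibility clause
NO component can be pinned** — any healing data on the toy skeleton has an EMPTY pin type, because healing one of the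
two components of the admissible family `{0, 1}` would produce the inadmissible singleton family. [folklore] -/
theorem toy_not_healable {Pin : Type*} (D : HIndex.HealingData (admSkeleton (Fin 2) toyAdm toyAdm_empty) Pin) :
    IsEmpty Pin := by
  refine ⟨fun x => ?_⟩
  let a : (admSkeleton (Fin 2) toyAdm toyAdm_empty).Adm := ⟨(∅, Finset.univ), Or.inr rfl⟩
  have hx : D.comp x ∈ (admSkeleton (Fin 2) toyAdm toyAdm_empty).Ys a := Finset.mem_univ _
  have hYs : (admSkeleton (Fin 2) toyAdm toyAdm_empty).Ys (D.drop a x) = Finset.univ.erase (D.comp x) :=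
    D.Ys_drop a x hx
  have hadm : toyAdm (D.drop a x).1 := (D.drop a x).2
  have hYs' : (D.drop a x).1.2 = Finset.univ.erase (D.comp x) := hYs
  rcases hadm with h | h
  · have : D.comp x ∈ (Finset.univ : Finset (Fin 2)).erase (D.comp x) → False := fun hm =>
      (Finset.ne_of_mem_erase hm) rfl
    have hne : ((Finset.univ : Finset (Fin 2)).erase (D.comp x)).Nonempty := by
      rw [← Finset.card_pos, Finset.card_erase_of_mem (Finset.mem_univ _), Finset.card_univ, Fintype.card_fin]
      norm_num
    rw [← hYs', h] at hne
    exact Finset.not_nonempty_empty hne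
  · have hm : D.comp x ∈ (D.drop a x).1.2 := by rw [h]; exact Finset.mem_univ _
    rw [hYs'] at hm
    exact (Finset.ne_of_mem_erase hm) rfl

end Summit.QuantumFields.BalabanUV.T4Continuum.NE7b.HealingMapSkeleton
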